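import Summits.PneNP.PneNP.Theorems.ChebyshevTracialDesignPairContainmentEntrywise
import Summits.PneNP.PneNP.Theorems.ChebyshevTracialDesignFiniteValued
import Summits.PneNP.PneNP.Theorems.ChebyshevTracialDesignFreeBinning
import HarnessLib

/-!
# Cell pnp-psdrank, route `ChebyshevTracialDesign`: the MATCHING-SIDE mirror of brick 168 — `Y_M = h(M)·K(π_M|_S)` (an ARBITRARY matching mask times ANY
# psd-contraction-valued junta of the matching's partners on `S`) against an ARBITRARY psd contraction cut field is priced by the `r = 1` rung at every
# dimension: value `≤ G·n^{|S|}·γ·r` (brick 169; crux `TracialDecayExp20`, stmt-PneNP-19878)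

Brick 169 (prover g32; MEMO-35 §3(d)/§4). Brick 168 (`…MaskedJuntaFactor`) conditions on the CUT pattern `U ∩ S`; the all-rectangle bound of the `r = 1` rung
is symmetric in the two sides (`…PairContainmentEntrywise.sum_mul_mul_le_of_rectangles` takes `[0,1]`-weights on cuts AND on matchings), so the same one-line
mechanism prices NONNEGATIVE SEPARABLE MATCHING FIELDS `Y_M = Σ_k b_k(M)·K_k` (`0 ≤ b_k ≤ 1`, `0 ⪯ K_k ⪯ I`, `|K|` generators) against EVERY psd contraction cut
field `X` of any dimension `r`: `Σ_{U,M} W(U,M)·tr(X_U Y_M) ≤ |K|·γ·r`. The instance: a matching MASK times a JUNTA OF THE PARTNER MAP,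
`Y_M = h(M)·K(π_M|_S)` (`K` indexed by the `n^{|S|}` partner assignments `σ : S → [n]`, generator weights `h(M)·1[π_M|_S = σ]`).
* §1 **`value_le_of_nonnegSeparable_matchingSide`** — the mirror of brick 168 §1.
* §2 **`value_maskedPartnerJunta_le`** — `X` any psd contraction field, `0 ≤ h ≤ G`, `K : (S → [n]) → Sym_r` with `0 ⪯ K(σ) ⪯ I`:
  `Σ_{U,M} W(U,M)·h(M)·tr(X_U·K(π_M|_S)) ≤ G·n^{|S|}·γ·r`.
* §3 **`maskedPartnerJunta_value_decay`** — UNCONDITIONAL for the route's designs (`γ = 20·e^{−a·dq n}`): exponentially small while `|S| ≤ a·dq n/(2 ln n)`.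
READING. With N1 (`…JuntaMatchingVirtualPositivity`: junta ⊗ junta, EXACT `≤ 0`), 168 (cut-side junta factor × arbitrary cut mask, any `Y`) and 169
(matching-side partner-junta factor × arbitrary matching mask, any `X`) every ONE-SIDED junta structure of size `≲ dq n` is priced at every dimension with
the OTHER side and the same side's scalar mask completely free. The census sentence of MEMO-35 §4 is unchanged: what no conditioning argument reaches is a
pair of fields neither of which has small nonnegative-separable rank — e.g. the coordinate strategy `X_U = f(U)·x_Ux_Uᵀ/t` (rank `≍ #cuts` in the
nonnegative separable sense) — i.e. (CG_1′)/(PC) for densely supported fields.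
[cite: Rothvoss2017, §2 and Lemma 7 (PDF pp. 6–8)] [cite: KeevashLifshitz2023, Thm. 1.8] [cite: GriblingDelaatLaurent2019, §5]
Stature: support/instrument (kernel lane, no defs, axioms standard; a RUNG-type statement for a named strategy class; §3 ASYMPTOTIC). WHAT THIS IS NOT:
nothing for densely supported factors, no proof or refutation of `TracialDecayExp20`, nothing on psd rank of P_PM(K_n) beyond the rungs, no P-vs-NP
content. Supports stmt-PneNP-19878.
-/

set_option linter.dupNamespace false -- `Summit.PneNP.PneNP.…`: summit = sub-problem (D-0017)

noncomputable section

namespace Summit.PneNP.PneNP.Theorems.ChebyshevTracialDesignMaskedJuntaFactorMatchingSide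

open Finset Matrix Literature.Barriers.PneNP Literature.Combinatorics.Optimization
open Summit.PneNP.PneNP.Theorems.ChebyshevTracialDesignPairContainmentEntrywise (sum_mul_mul_le_of_rectangles rectBound_nonneg)
open Summit.PneNP.PneNP.Theorems.ChebyshevTracialDesignFiniteValued (trace_mul_le_card)
open Summit.PneNP.PneNP.Theorems.ChebyshevTracialDesignFreeBinning (trace_mul_nonneg_of_psd)
open Summit.PneNP.PneNP.Theorems.ChebyshevTracialDesignUnconditionalRungs (rectangleDecayExp_all_holds)

variable {n : ℕ}

/-! ### §1 Nonnegative separable MATCHING fields -/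

/-- **NONNEGATIVE SEPARABLE MATCHING FIELDS ARE PRICED BY THE `r = 1` RUNG, AT EVERY DIMENSION** (mirror of brick 168 §1). Let `W` be any weight whose
mass on every 0/1 rectangle is `≤ γ`, `K` a finite index type, `b_k : PM → [0,1]`, `K_k` psd contractions of dimension `r`, and `X` a psd contraction
cut field. Then `Σ_{U,M} W(U,M)·tr(X_U·(Σ_k b_k(M)·K_k)) ≤ |K|·γ·r`. [cite: Rothvoss2017, §2 and Lemma 7 (PDF pp. 6–8)] [cite: GriblingDelaatLaurent2019, §5] -/
theorem value_le_of_nonnegSeparable_matchingSide (W : OddSet n → PMatch n → ℝ) {γ : ℝ}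
    (hR : ∀ (A : Finset (OddSet n)) (B : Finset (PMatch n)), ∑ U ∈ A, ∑ M ∈ B, W U M ≤ γ)
    {K : Type*} [Fintype K] {r : ℕ} (b : K → PMatch n → ℝ) (hb : ∀ k M, 0 ≤ b k M ∧ b k M ≤ 1)
    (Kk : K → Matrix (Fin r) (Fin r) ℝ) (hK : ∀ k, (Kk k).PosSemidef ∧ (1 - Kk k).PosSemidef)
    (X : OddSet n → Matrix (Fin r) (Fin r) ℝ) (hX : ∀ U, (X U).PosSemidef ∧ (1 - X U).PosSemidef) :
    ∑ U : OddSet n, ∑ M : PMatch n, W U M * (X U * ∑ k, b k M • Kk k).trace ≤ (Fintype.card K : ℝ) * γ * r := by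
  classical
  have hγ : 0 ≤ γ := rectBound_nonneg W hR
  rcases Nat.eq_zero_or_pos r with hr | hr
  · subst hr
    have : ∀ (U : OddSet n) (M : PMatch n), (X U * ∑ k, b k M • Kk k).trace = 0 := fun U M => by
      rw [Matrix.trace]; simp
    simp only [this, mul_zero, sum_const_zero, Nat.cast_zero]
    exact le_refl _
  have hrpos : (0 : ℝ) < r := by exact_mod_cast hr
  -- `tr(X_U K_k) = tr(K_k X_U) ∈ [0, r]`
  have htr0 : ∀ k U, 0 ≤ (X U * Kk k).trace := fun k U => trace_mul_nonneg_of_psd (hX U).1 (hK k).1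
  have htr1 : ∀ k U, (X U * Kk k).trace ≤ r := fun k U => trace_mul_le_card (hX U).2 (hK k).1 (hK k).2
  have ha : ∀ k U, 0 ≤ (X U * Kk k).trace / r ∧ (X U * Kk k).trace / r ≤ 1 := fun k U =>
    ⟨div_nonneg (htr0 k U) hrpos.le, (div_le_one hrpos).2 (htr1 k U)⟩
  have hexp : ∀ (U : OddSet n) (M : PMatch n), (X U * ∑ k, b k M • Kk k).trace = ∑ k, b k M * (X U * Kk k).trace := by
    intro U M
    rw [Matrix.mul_sum, Matrix.trace_sum]
    refine sum_congr rfl fun k _ => ?_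
    rw [Matrix.mul_smul, Matrix.trace_smul, smul_eq_mul]
  have hswap : ∑ U : OddSet n, ∑ M : PMatch n, W U M * (X U * ∑ k, b k M • Kk k).trace =
      ∑ k, (r : ℝ) * ∑ U : OddSet n, ∑ M : PMatch n, W U M * (((X U * Kk k).trace / r) * b k M) := by
    calc ∑ U : OddSet n, ∑ M : PMatch n, W U M * (X U * ∑ k, b k M • Kk k).trace
        = ∑ U : OddSet n, ∑ M : PMatch n, ∑ k, W U M * (b k M * (X U * Kk k).trace) := by
          refine sum_congr rfl fun U _ => sum_congr rfl fun M _ => ?_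
          rw [hexp, mul_sum]
      _ = ∑ U : OddSet n, ∑ k, ∑ M : PMatch n, W U M * (b k M * (X U * Kk k).trace) := sum_congr rfl fun U _ => sum_comm
      _ = ∑ k, ∑ U : OddSet n, ∑ M : PMatch n, W U M * (b k M * (X U * Kk k).trace) := sum_comm
      _ = ∑ k, (r : ℝ) * ∑ U : OddSet n, ∑ M : PMatch n, W U M * (((X U * Kk k).trace / r) * b k M) := by
          refine sum_congr rfl fun k _ => ?_
          rw [mul_sum]; refine sum_congr rfl fun U _ => ?_
          rw [mul_sum]; refine sum_congr rfl fun M _ => ?_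
          field_simp
  rw [hswap]
  calc ∑ k, (r : ℝ) * ∑ U : OddSet n, ∑ M : PMatch n, W U M * (((X U * Kk k).trace / r) * b k M)
      ≤ ∑ _k : K, (r : ℝ) * γ := sum_le_sum fun k _ =>
        mul_le_mul_of_nonneg_left (sum_mul_mul_le_of_rectangles W hR (fun U => (X U * Kk k).trace / r) (b k) (ha k) (hb k)) hrpos.le
    _ = (Fintype.card K : ℝ) * γ * r := by rw [sum_const, card_univ, nsmul_eq_mul]; ring

/-! ### §2 Matching mask × partner junta -/

/-- **MATCHING MASK × PARTNER JUNTA.** Any weight `W` with all-rectangle bound `γ`; `X` any psd contraction cut field; `0 ≤ h ≤ G` a matching mask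
(no structure); `K : (S → [n]) → Sym_r` with `0 ⪯ K(σ) ⪯ I`; then with `π_M|_S : S → [n]` the partners of `S` in `M`,
`Σ_{U,M} W(U,M)·h(M)·tr(X_U·K(π_M|_S)) ≤ G·n^{|S|}·γ·r`. [cite: Rothvoss2017, §2 and Lemma 7 (PDF pp. 6–8)] [cite: GriblingDelaatLaurent2019, §5] -/
theorem value_maskedPartnerJunta_le (W : OddSet n → PMatch n → ℝ) {γ : ℝ}
    (hR : ∀ (A : Finset (OddSet n)) (B : Finset (PMatch n)), ∑ U ∈ A, ∑ M ∈ B, W U M ≤ γ)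
    (S : Finset (Fin n)) {r : ℕ} (X : OddSet n → Matrix (Fin r) (Fin r) ℝ) (hX : ∀ U, (X U).PosSemidef ∧ (1 - X U).PosSemidef)
    (h : PMatch n → ℝ) {G : ℝ} (hG : 0 ≤ G) (hh : ∀ M, 0 ≤ h M ∧ h M ≤ G)
    (K : (S → Fin n) → Matrix (Fin r) (Fin r) ℝ) (hK : ∀ σ, (K σ).PosSemidef ∧ (1 - K σ).PosSemidef) :
    ∑ U : OddSet n, ∑ M : PMatch n, W U M * (h M * (X U * K (fun s : S => M.2.partner s.1)).trace) ≤
      G * ((n : ℝ) ^ S.card * γ * r) := by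
  classical
  rcases eq_or_lt_of_le hG with hG0 | hGpos
  · have hh0 : ∀ M, h M = 0 := fun M => le_antisymm (hG0 ▸ (hh M).2) (hh M).1
    have : ∑ U : OddSet n, ∑ M : PMatch n, W U M * (h M * (X U * K (fun s : S => M.2.partner s.1)).trace) = 0 :=
      sum_eq_zero fun U _ => sum_eq_zero fun M _ => by rw [hh0 M]; ring
    rw [this, ← hG0, zero_mul]
  -- generator weights `b_σ(M) = (h(M)/G)·1[π_M|_S = σ]`
  set b : (S → Fin n) → PMatch n → ℝ := fun σ M => if (fun s : S => M.2.partner s.1) = σ then h M / G else 0 with hbdef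
  have hb : ∀ σ M, 0 ≤ b σ M ∧ b σ M ≤ 1 := fun σ M => by
    simp only [hbdef]; split_ifs
    · exact ⟨div_nonneg (hh M).1 hG, (div_le_one hGpos).2 (hh M).2⟩
    · exact ⟨le_rfl, zero_le_one⟩
  have hsum : ∀ M : PMatch n, ∑ σ : S → Fin n, b σ M • K σ = (h M / G) • K (fun s : S => M.2.partner s.1) := by
    intro M
    have h2 : ∀ σ : S → Fin n, b σ M • K σ = if (fun s : S => M.2.partner s.1) = σ then (h M / G) • K σ else 0 := fun σ => by
      simp only [hbdef]; split_ifs <;> simp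
    rw [Fintype.sum_congr _ _ h2, Finset.sum_ite_eq, if_pos (mem_univ _)]
  have hterm : ∀ (U : OddSet n) (M : PMatch n), W U M * (h M * (X U * K (fun s : S => M.2.partner s.1)).trace) =
      G * (W U M * (X U * ∑ σ : S → Fin n, b σ M • K σ).trace) := by
    intro U M
    rw [hsum M, Matrix.mul_smul, Matrix.trace_smul, smul_eq_mul]
    field_simp
  calc ∑ U : OddSet n, ∑ M : PMatch n, W U M * (h M * (X U * K (fun s : S => M.2.partner s.1)).trace)
      = G * ∑ U : OddSet n, ∑ M : PMatch n, W U M * (X U * ∑ σ : S → Fin n, b σ M • K σ).trace := by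
        rw [mul_sum]; refine sum_congr rfl fun U _ => ?_
        rw [mul_sum]; exact sum_congr rfl fun M _ => hterm U M
    _ ≤ G * ((Fintype.card (S → Fin n) : ℝ) * γ * r) :=
        mul_le_mul_of_nonneg_left (value_le_of_nonnegSeparable_matchingSide W hR b hb K hK X hX) hG
    _ = G * ((n : ℝ) ^ S.card * γ * r) := by
        rw [Fintype.card_fun, Fintype.card_coe, Fintype.card_fin]; push_cast; ring

/-! ### §3 The design corollary (unconditional) -/

/-- **MATCHING MASK × PARTNER JUNTA, for balanced Chebyshev designs — UNCONDITIONAL, EVERY DIMENSION.** For some `a > 0` and all large even `n`: every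
balanced exact design `(t, C, w)` of degree `dq n` on levels `≤ Tq n` with `Σ|w_c| ≤ 20`, every vertex set `S`, every psd contraction cut field `X`, every
matching mask `0 ≤ h ≤ G`, every `K : (S → [n]) → Sym_r` with `0 ⪯ K(σ) ⪯ I`:
`Σ_{U,M} W(U,M)·h(M)·tr(X_U·K(π_M|_S)) ≤ G·n^{|S|}·20·exp(−a·dq n)·r`.
[cite: Rothvoss2017, §2 and Lemma 7 (PDF pp. 6–8)] [cite: KeevashLifshitz2023, Thm. 1.8] [cite: GriblingDelaatLaurent2019, §5] -/
theorem maskedPartnerJunta_value_decay :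
    ∃ a : ℝ, 0 < a ∧ ∃ n₁ : ℕ, ∀ n : ℕ, n₁ ≤ n → Even n → ∀ (t : ℕ) (C : Finset ℕ) (w : ℕ → ℝ),
      IsBalancedDesign n t (Tq n) (dq n) 20 C w → ∀ (S : Finset (Fin n)) {r : ℕ}
        (X : OddSet n → Matrix (Fin r) (Fin r) ℝ), (∀ U, (X U).PosSemidef ∧ (1 - X U).PosSemidef) →
        ∀ (h : PMatch n → ℝ) (G : ℝ), 0 ≤ G → (∀ M, 0 ≤ h M ∧ h M ≤ G) →
        ∀ (K : (S → Fin n) → Matrix (Fin r) (Fin r) ℝ), (∀ σ, (K σ).PosSemidef ∧ (1 - K σ).PosSemidef) →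
          ∑ U : OddSet n, ∑ M : PMatch n, levelWeight n t C w U M * (h M * (X U * K (fun s : S => M.2.partner s.1)).trace) ≤
            G * ((n : ℝ) ^ S.card * (20 * Real.exp (-(a * (dq n : ℝ)))) * r) := by
  obtain ⟨a, ha, n₁, hrung⟩ := rectangleDecayExp_all_holds
  exact ⟨a, ha, n₁, fun n hn hev t C w hdes S r X hX h G hG hh K hK =>
    value_maskedPartnerJunta_le _ (hrung n hn hev t C w hdes) S X hX h hG hh K hK⟩

end Summit.PneNP.PneNP.Theorems.ChebyshevTracialDesignMaskedJuntaFactorMatchingSide
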